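import Literature.Computability.AlgebraicComplexity.KV20CoefficientQueryFP
import Literature.Computability.Complexity.SuccinctCircuitBitsReadout
import HarnessLib

/-!
# Kumar–Volk 2020/2022, Cor 1.3 (M1 programme, step (P6c), abstract form): Cor 1.3 from a
# two's-complement READ-OUT of the kernel vector inside ANY succinct circuit

Source: M. Kumar, B. L. Volk, *A polynomial degree bound on equations for non-rigid matrices and
small linear circuits*, ACM TOCT 14(2) (2022) art. 6 = arXiv:2003.12938 [KumarVolk2022], §6 (= arXiv
§5), proof of Cor 1.3 ("a fixed PSPACE algorithm … outputs the list of coefficients of `Q_n` … by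
standard small-space linear algebra"). In the val-lit cell's reduction of record the remaining
hypothesis of `kumarVolk2020_cor_1_3` is the ONE membership
`coeffBitLanguage kvCanonicalFamily ∈ PSPACE` (x5, `KV20Cor13OfPSPACEEquations.lean`), normalised by
t21 g11 (`KV20CoefficientQueryFP.lean`) to a KERNEL-ENTRY ORACLE: a `PSPACE` language answering the
bit/sign queries `BitSignQuery (kvKernelEntry n c) j s` of the integers `kvKernelEntry n c` (entry `c`
of the canonical kernel vector of the Gram matrix of the canonical system). The machine side of the
programme (p1 g9, `Complexity/SuccinctCircuitBits*.lean`) supplies, for EVERY `FP`-succinct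
poly-depth circuit `K : SuccCircuit`, `K.bitLang ∈ PSPACE` (the bits of all gate values) and the
two's-complement read-out of integers carried by natural gate values
(`SuccinctCircuitBitsSigned.lean`: `neg_iff_testBit`, `testBit_natAbs_of_nonneg`; part VII
`SuccinctCircuitBitsReadout.lean`: bit queries through polynomial-time name/index maps are `PSPACE`
predicates, `setOf_testBit_val_mem_PSPACE`, and the generic sign–magnitude language
`signMag_mem_PSPACE_of_rep`, whose representative hypotheses are TOTAL in the query string — here
they are needed on the query RANGE `1 ≤ n`, `c < (n³+1)^{n²}` only, which is what a kernel-entry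
oracle asks and what a circuit file can supply).

This file CLOSES THE GAP BETWEEN THE TWO in the abstract: it proves Cor 1.3 from any succinct
circuit `K` together with polynomial-time NAME maps `X, X' : (n, c) ↦ gate` and a polynomial-time
width `v` such that, for `n ≥ 1` and `c` in the column range,
`K.val (X n c) ≡ kvKernelEntry n c` and `K.val (X' n c) ≡ −kvKernelEntry n c (mod 2^{v n + 1})`
with `|kvKernelEntry n c| < 2^{v n}` — the shape in which the circuit files of the programme
(x5 g7, `Complexity/SuccinctKernelVector*.lean`) deliver the kernel vector (as a difference
`V⁺ − V⁻` of two ℕ-valued gates; the exact-gate corollary `…_of_splitGates` takes that form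
directly: two more sum gates `X = V⁺ + (2^{v+1} − 1)·V⁻`, `X' = V⁻ + (2^{v+1} − 1)·V⁺`).

* §1 `bitSignQuery_iff_twosComplement` — pure arithmetic: the bit/sign queries of an integer `z`
  with `|z| < 2^v` in terms of the bits of representatives `X ≡ z`, `X' ≡ −z (mod 2^{v+1})`
  (sign = bit `v` of `X`; magnitude bits = bits `j ≤ v` of `X` if the sign bit is clear, of `X'` if
  it is set).
* §2 ★ `coeffBitLanguage_kvCanonicalFamily_mem_PSPACE_of_twosComplementReadout` and
  ★ `kumarVolk2020_cor_1_3_of_twosComplementReadout` — the oracle language is a Boolean combination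
  of `P` tests on the decoded query and three preimages of `K.bitLang` under polynomial-time maps,
  hence in `PSPACE` (`preimage_mem_PSPACE`, `compl_mem_PSPACE`, closure under `∧`/`∨` through the
  tree's `PSPACE`-complete language), and it is a kernel-entry oracle by §1; then
  `kumarVolk2020_cor_1_3_of_kernelEntryOracle`.
* §3 `kumarVolk2020_cor_1_3_of_splitGates` — the same from four ℕ-valued gate families
  `V⁺, V⁻, X, X'` with `V⁺ − V⁻ = kvKernelEntry`, `V± < 2^v`, and the EXACT gate equations
  `X = V⁺ + (2^{v+1} − 1)·V⁻`, `X' = V⁻ + (2^{v+1} − 1)·V⁺` (what `val_sum`/`val_mul`/`val_const` give).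

Theorems only; 0 `def`s, 0 named facts; census +0. HONEST FRAMING (val-lit, KV20 M1 programme,
RULING (120)): Boolean plumbing; `kumarVolk2020_cor_1_3` stays OPEN by name until a circuit with
such a read-out is instantiated on the canonical system (the circuit files of the programme);
`VP ≠ VNP` is NOT proved and nothing in this file bears on it.

## References

* [KumarVolk2022] M. Kumar, B. L. Volk, ACM TOCT 14(2) (2022) art. 6 = arXiv:2003.12938, §6 /
  arXiv §5 p0009:L1–3 (proof of Cor 1.3).
* [KoiranPerifel2009VPSPACE] P. Koiran, S. Perifel, *VPSPACE and a transfer theorem over the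
  reals*, Comput. Complexity 18 (2009), §3.1 Def. 1 (coefficient function: bit `i` and the sign),
  §3.2 Prop. 1.
* [KnuthTAOCP2] D. E. Knuth, *The Art of Computer Programming 2*, §4.1 (two's complement).
* [AroraBarakCC2009] S. Arora, B. Barak, *Computational Complexity: A Modern Approach*, CUP 2009,
  §4.2 (closure properties of `PSPACE`), §1.3, Def. 1.13.
-/

noncomputable section

namespace Literature.Computability.AlgebraicComplexity

namespace KumarVolk2020

namespace UEval

open Literature.Computability.Complexity CodeFP SuccCircuit

/-! ### §1. Bit/sign queries through a two's-complement pair (arithmetic) -/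

/-- **Bit/sign queries of `z` from representatives `X ≡ z`, `X' ≡ −z (mod 2^{v+1})`, `|z| < 2^v`:**
`z < 0` iff bit `v` of `X` is set; for `j ≤ v`, bit `j` of `|z|` is bit `j` of `X` when the sign bit
is clear and bit `j` of `X'` when it is set; bits `j > v` of `|z|` vanish.
[cite: KnuthTAOCP2, §4.1] [cite: KoiranPerifel2009VPSPACE, §3.1 Def. 1] -/
theorem bitSignQuery_iff_twosComplement {z : ℤ} {v X X' j s : ℕ} (hz : z.natAbs < 2 ^ v)
    (hX : (X : ℤ) ≡ z [ZMOD 2 ^ (v + 1)]) (hX' : (X' : ℤ) ≡ -z [ZMOD 2 ^ (v + 1)]) :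
    BitSignQuery z j s ↔
      (s = 1 ∧ X.testBit v = true) ∨
        (s = 0 ∧ j ≤ v ∧ ((X.testBit v = false ∧ X.testBit j = true) ∨
          (X.testBit v = true ∧ X'.testBit j = true))) := by
  have hsign : z < 0 ↔ X.testBit v = true := neg_iff_testBit hz hX
  have hz' : (-z).natAbs < 2 ^ v := by rwa [Int.natAbs_neg]
  unfold BitSignQuery
  constructor
  · rintro (⟨rfl, hbit⟩ | ⟨rfl, hneg⟩)
    · refine Or.inr ⟨rfl, ?_, ?_⟩
      · by_contra hjv
        rw [testBit_natAbs_eq_false hz (le_of_lt (not_le.1 hjv))] at hbit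
        exact Bool.false_ne_true hbit
      · have hj : j ≤ v := by
          by_contra hjv
          rw [testBit_natAbs_eq_false hz (le_of_lt (not_le.1 hjv))] at hbit
          exact Bool.false_ne_true hbit
        by_cases h0 : 0 ≤ z
        · refine Or.inl ⟨?_, ?_⟩
          · have : ¬ X.testBit v = true := fun h => (not_lt.2 h0) (hsign.2 h)
            simpa using this
          · rwa [testBit_natAbs_of_nonneg h0 hz hX hj] at hbit
        · have hneg : z < 0 := lt_of_not_ge h0
          refine Or.inr ⟨hsign.1 hneg, ?_⟩
          have h := testBit_natAbs_of_nonneg (neg_nonneg.2 hneg.le) hz' hX' hj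
          rw [Int.natAbs_neg] at h
          rwa [h] at hbit
    · exact Or.inl ⟨rfl, hsign.1 hneg⟩
  · rintro (⟨rfl, hb⟩ | ⟨rfl, hj, hcase⟩)
    · exact Or.inr ⟨rfl, hsign.2 hb⟩
    · refine Or.inl ⟨rfl, ?_⟩
      rcases hcase with ⟨hvF, hbj⟩ | ⟨hvT, hbj'⟩
      · have h0 : 0 ≤ z := by
          by_contra h0
          have := hsign.1 (lt_of_not_ge h0)
          rw [hvF] at this
          exact Bool.false_ne_true this
        rw [testBit_natAbs_of_nonneg h0 hz hX hj]
        exact hbj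
      · have hneg : z < 0 := hsign.2 hvT
        have h := testBit_natAbs_of_nonneg (neg_nonneg.2 hneg.le) hz' hX' hj
        rw [Int.natAbs_neg] at h
        rw [h]
        exact hbj'

/-! ### §2. The read-out oracle is in `PSPACE`; Cor 1.3 -/

section Readout

variable (K : SuccCircuit) {X X' : ℕ → ℕ → List Bool} {v : ℕ → ℕ}

/-- The kind test `s = k` on oracle codes is a `P` language (a copy of t21 g11's private lemma).
[cite: AroraBarakCC2009, Def. 1.13] -/
private theorem kindEq_mem_P' (k : ℕ) : ({w | (decOQ w).2.2.2 = k} : Language Bool) ∈ Classes.P := by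
  obtain ⟨G, hG, hGw⟩ :=
    (natEq.comp (codeFP_decOQ_s.pair (CodeFP.const strE (eβ := natE) k)) :
      CodeFP strE bitE fun w => decide ((decOQ w).2.2.2 = k))
  refine mem_P_of_mem_FP hG _ fun w => ⟨fun hw => ?_, fun hw => ?_⟩
  · rw [show G w = bitE (decide ((decOQ w).2.2.2 = k)) from hGw w, decide_eq_true (show _ = k from hw)]; rfl
  · rw [show G w = bitE (decide ((decOQ w).2.2.2 = k)) from hGw w, decide_eq_false (show ¬ _ = k from hw)]; rfl

/-- The guard `j ≤ v n` on oracle codes is a `P` language (polynomial-time width `v`).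
[cite: AroraBarakCC2009, Def. 1.13] -/
private theorem jLe_mem_P (hv : CodeFP unE natE v) :
    ({w | (decOQ w).2.2.1 ≤ v (decOQ w).1} : Language Bool) ∈ Classes.P := by
  obtain ⟨G, hG, hGw⟩ :=
    (natLe.comp (codeFP_decOQ_j.pair (hv.comp codeFP_decOQ_n)) :
      CodeFP strE bitE fun w => decide ((decOQ w).2.2.1 ≤ v (decOQ w).1))
  refine mem_P_of_mem_FP hG _ fun w => ⟨fun hw => ?_, fun hw => ?_⟩
  · rw [show G w = bitE (decide ((decOQ w).2.2.1 ≤ v (decOQ w).1)) from hGw w,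
      decide_eq_true (show _ ≤ _ from hw)]; rfl
  · rw [show G w = bitE (decide ((decOQ w).2.2.1 ≤ v (decOQ w).1)) from hGw w,
      decide_eq_false (show ¬ _ ≤ _ from hw)]; rfl

/-- **A bit of a range-decoded gate is a `PSPACE` test on oracle codes** (p1 g9's
`setOf_testBit_val_mem_PSPACE` with the gate read through `decOQ`). [cite: KoiranPerifel2009VPSPACE, §3.2 Prop. 1] [cite: AroraBarakCC2009, §4.2] -/
private theorem gateBit_mem_PSPACE {Y : ℕ → ℕ → List Bool} {i : List Bool → ℕ}
    (hY : CodeFP (pairE unE natE) strE (fun p => Y p.1 p.2)) (hi : CodeFP strE natE i) :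
    ({w | (K.val (Y (decOQ w).1 (decOQ w).2.1)).testBit (i w) = true} : Language Bool) ∈ PSPACE :=
  K.setOf_testBit_val_mem_PSPACE
    ((hY.comp (codeFP_decOQ_n.pair codeFP_decOQ_c) :
      CodeFP strE strE (fun w => Y (decOQ w).1 (decOQ w).2.1))) hi

/-- The complementary test (bit clear). [cite: AroraBarakCC2009, §4.2] -/
private theorem gateBitFalse_mem_PSPACE {Y : ℕ → ℕ → List Bool} {i : List Bool → ℕ}
    (hY : CodeFP (pairE unE natE) strE (fun p => Y p.1 p.2)) (hi : CodeFP strE natE i) :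
    ({w | (K.val (Y (decOQ w).1 (decOQ w).2.1)).testBit (i w) = false} : Language Bool) ∈ PSPACE := by
  have h := compl_mem_PSPACE (gateBit_mem_PSPACE K hY hi)
  have hset : ({w | (K.val (Y (decOQ w).1 (decOQ w).2.1)).testBit (i w) = false} : Language Bool) =
      ({w | (K.val (Y (decOQ w).1 (decOQ w).2.1)).testBit (i w) = true} : Language Bool)ᶜ := by
    ext w
    show _ = false ↔ ¬ (_ = true)
    rw [Bool.eq_false_iff]
  rw [hset]
  exact h

/-- ★ **Cor 1.3's `hbits` from a two's-complement read-out in a succinct circuit.** For a succinct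
poly-depth circuit `K`, polynomial-time gate names `X n c`, `X' n c` and a polynomial-time width
`v n` with `K.val (X n c) ≡ kvKernelEntry n c`, `K.val (X' n c) ≡ −kvKernelEntry n c (mod 2^{v n+1})`
and `|kvKernelEntry n c| < 2^{v n}` (`n ≥ 1`, `c < (n³+1)^{n²}`), the coefficient bit language of the
canonical Kumar–Volk family is in `PSPACE`. [cite: KumarVolk2022, Cor. 1.3 (proof, §6)] [cite: KoiranPerifel2009VPSPACE, §3.2 Prop. 1] [cite: AroraBarakCC2009, §4.2] -/
theorem coeffBitLanguage_kvCanonicalFamily_mem_PSPACE_of_twosComplementReadout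
    (hX : CodeFP (pairE unE natE) strE (fun p => X p.1 p.2))
    (hX' : CodeFP (pairE unE natE) strE (fun p => X' p.1 p.2)) (hv : CodeFP unE natE v)
    (hlt : ∀ n c : ℕ, 1 ≤ n → c < (n ^ 3 + 1) ^ (n * n) → (kvKernelEntry n c).natAbs < 2 ^ v n)
    (hrep : ∀ n c : ℕ, 1 ≤ n → c < (n ^ 3 + 1) ^ (n * n) →
      (K.val (X n c) : ℤ) ≡ kvKernelEntry n c [ZMOD 2 ^ (v n + 1)])
    (hrep' : ∀ n c : ℕ, 1 ≤ n → c < (n ^ 3 + 1) ^ (n * n) →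
      (K.val (X' n c) : ℤ) ≡ -kvKernelEntry n c [ZMOD 2 ^ (v n + 1)]) :
    coeffBitLanguage kvCanonicalFamily ∈ PSPACE := by
  obtain ⟨B, hB⟩ := exists_isComplete_PSPACE_holds
  -- the read-out predicate on decoded queries
  let P : ℕ → ℕ → ℕ → ℕ → Prop := fun n c j s =>
    (s = 1 ∧ (K.val (X n c)).testBit (v n) = true) ∨
      (s = 0 ∧ (j ≤ v n ∧ (((K.val (X n c)).testBit (v n) = false ∧ (K.val (X n c)).testBit j = true) ∨
        ((K.val (X n c)).testBit (v n) = true ∧ (K.val (X' n c)).testBit j = true))))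
  have hLO : KernelEntryOracle (oracleLang P) :=
    kernelEntryOracle_oracleLang fun n c j s hn hc => by
      rw [bitSignQuery_iff_twosComplement (hlt n c hn hc) (hrep n c hn hc) (hrep' n c hn hc)]
  -- the width read at the decoded `n`, the positions read from the code
  have hvn : CodeFP strE natE (fun w => v (decOQ w).1) := (hv.comp codeFP_decOQ_n :)
  have hsgn := gateBit_mem_PSPACE K hX hvn
  have hsgnF := gateBitFalse_mem_PSPACE K hX hvn
  have hbit := gateBit_mem_PSPACE K hX codeFP_decOQ_j
  have hbit' := gateBit_mem_PSPACE K hX' codeFP_decOQ_j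
  have hLP : oracleLang P ∈ PSPACE :=
    setOf_or_mem_PSPACE_of_complete hB
      (setOf_and_mem_PSPACE_of_complete hB (P_subset_PSPACE_holds (kindEq_mem_P' 1)) hsgn)
      (setOf_and_mem_PSPACE_of_complete hB (P_subset_PSPACE_holds (kindEq_mem_P' 0))
        (setOf_and_mem_PSPACE_of_complete hB (P_subset_PSPACE_holds (jLe_mem_P hv))
          (setOf_or_mem_PSPACE_of_complete hB
            (setOf_and_mem_PSPACE_of_complete hB hsgnF hbit)
            (setOf_and_mem_PSPACE_of_complete hB hsgn hbit'))))
  exact coeffBitLanguage_kvCanonicalFamily_mem_PSPACE_of hLO hLP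

/-- ★ **Kumar–Volk Cor 1.3 from a two's-complement read-out in a succinct circuit** (the closer's
abstract form: instantiate `K`, `X`, `X'`, `v` with the kernel-vector circuit of the canonical
system). [cite: KumarVolk2022, Cor. 1.3 (proof, §6)] -/
theorem kumarVolk2020_cor_1_3_of_twosComplementReadout
    (hX : CodeFP (pairE unE natE) strE (fun p => X p.1 p.2))
    (hX' : CodeFP (pairE unE natE) strE (fun p => X' p.1 p.2)) (hv : CodeFP unE natE v)
    (hlt : ∀ n c : ℕ, 1 ≤ n → c < (n ^ 3 + 1) ^ (n * n) → (kvKernelEntry n c).natAbs < 2 ^ v n)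
    (hrep : ∀ n c : ℕ, 1 ≤ n → c < (n ^ 3 + 1) ^ (n * n) →
      (K.val (X n c) : ℤ) ≡ kvKernelEntry n c [ZMOD 2 ^ (v n + 1)])
    (hrep' : ∀ n c : ℕ, 1 ≤ n → c < (n ^ 3 + 1) ^ (n * n) →
      (K.val (X' n c) : ℤ) ≡ -kvKernelEntry n c [ZMOD 2 ^ (v n + 1)]) :
    kumarVolk2020_cor_1_3 :=
  kumarVolk2020_cor_1_3_of_canonicalBits
    (coeffBitLanguage_kvCanonicalFamily_mem_PSPACE_of_twosComplementReadout K hX hX' hv hlt hrep hrep')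

end Readout

/-! ### §3. From split gates `V⁺, V⁻` and the two read-out sum gates -/

section SplitGates

variable (K : SuccCircuit) {Vp Vm X X' : ℕ → ℕ → List Bool} {v : ℕ → ℕ}

/-- `2^{v+1} − 1 ≡ −1 (mod 2^{v+1})`, so `a + (2^{v+1} − 1)·b ≡ a − b`. [cite: KnuthTAOCP2, §4.1] -/
private theorem add_allOnes_mul_modEq (v a b : ℕ) :
    ((a + (2 ^ (v + 1) - 1) * b : ℕ) : ℤ) ≡ (a : ℤ) - b [ZMOD 2 ^ (v + 1)] := by
  have h1 : (1 : ℕ) ≤ 2 ^ (v + 1) := Nat.one_le_two_pow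
  refine Int.modEq_iff_dvd.2 ⟨-(b : ℤ), ?_⟩
  push_cast [Nat.cast_sub h1]
  ring

/-- The difference of two naturals below `2^v` has absolute value below `2^v`. [folklore] -/
private theorem natAbs_sub_lt {a b v : ℕ} (ha : a < 2 ^ v) (hb : b < 2 ^ v) :
    ((a : ℤ) - b).natAbs < 2 ^ v := by
  omega

/-- ★ **Kumar–Volk Cor 1.3 from split ℕ-valued gates.** If a succinct poly-depth circuit `K` has,
for `n ≥ 1` and every column `c`, gates `V⁺ n c`, `V⁻ n c` below `2^{v n}` with
`V⁺ − V⁻ = kvKernelEntry n c`, and gates `X n c = V⁺ + (2^{v n+1} − 1)·V⁻`,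
`X' n c = V⁻ + (2^{v n+1} − 1)·V⁺` (exact values, as sum/product/constant gates give), the names
`X, X'` and the width `v` being polynomial time, then Cor 1.3 holds.
[cite: KumarVolk2022, Cor. 1.3 (proof, §6)] [cite: KnuthTAOCP2, §4.1] -/
theorem kumarVolk2020_cor_1_3_of_splitGates
    (hX : CodeFP (pairE unE natE) strE (fun p => X p.1 p.2))
    (hX' : CodeFP (pairE unE natE) strE (fun p => X' p.1 p.2)) (hv : CodeFP unE natE v)
    (hVp : ∀ n c : ℕ, 1 ≤ n → c < (n ^ 3 + 1) ^ (n * n) → K.val (Vp n c) < 2 ^ v n)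
    (hVm : ∀ n c : ℕ, 1 ≤ n → c < (n ^ 3 + 1) ^ (n * n) → K.val (Vm n c) < 2 ^ v n)
    (hval : ∀ n c : ℕ, 1 ≤ n → c < (n ^ 3 + 1) ^ (n * n) →
      (K.val (Vp n c) : ℤ) - K.val (Vm n c) = kvKernelEntry n c)
    (hXval : ∀ n c : ℕ, 1 ≤ n → c < (n ^ 3 + 1) ^ (n * n) →
      K.val (X n c) = K.val (Vp n c) + (2 ^ (v n + 1) - 1) * K.val (Vm n c))
    (hX'val : ∀ n c : ℕ, 1 ≤ n → c < (n ^ 3 + 1) ^ (n * n) →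
      K.val (X' n c) = K.val (Vm n c) + (2 ^ (v n + 1) - 1) * K.val (Vp n c)) :
    kumarVolk2020_cor_1_3 := by
  refine kumarVolk2020_cor_1_3_of_twosComplementReadout K hX hX' hv ?_ ?_ ?_
  · intro n c hn hc
    rw [← hval n c hn hc]
    exact natAbs_sub_lt (hVp n c hn hc) (hVm n c hn hc)
  · intro n c hn hc
    rw [hXval n c hn hc, ← hval n c hn hc]
    exact add_allOnes_mul_modEq _ _ _
  · intro n c hn hc
    rw [hX'val n c hn hc, ← hval n c hn hc, neg_sub]
    exact add_allOnes_mul_modEq _ _ _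

end SplitGates

end UEval

end KumarVolk2020

end Literature.Computability.AlgebraicComplexity

end
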